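import Mathlib
import HarnessLib
import Summits.ValiantsHypothesis.ValiantsHypothesis.Theses.MonotoneRestoration
import Literature.Computability.AlgebraicComplexity.ArithCircuit
import Summits.ValiantsHypothesis.ValiantsHypothesis.Theorems.MonotoneRestorationMonotoneRestorationQPSparseRegime

/-!
# `MonotoneRestorationQP` ⟺ its UNIFORM, SINGLE-POLYNOMIAL, HIGH-DEGREE core

Deep-seat decomposition of the crux `MonotoneRestorationQP` (stmt-ValiantsHypothesis-15886; TTRL
variant V13503 is the crux verbatim).  The crux quantifies over FAMILIES (`∃ c ∀ n` after the
family is fixed).  We prove it is equivalent to a statement about SINGLE matrix-symmetric polynomials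
`p ∈ ℝ≥0[x_ij : i, j < n]`, uniform in the exponent of the hypothesis class and restricted to the
super-polylogarithmic-degree regime:

`U' : ∀ c₀, ∃ c, ∀ n p, p matrix-symmetric → deg p ≤ (n+2)^c₀ → L⁺(p) ≤ (n+2)^c₀ →
  (log₂ n + c₀)^c₀ < deg p → p has a square-symmetric circuit over ℂ of size ≤ 2^((log₂ n + c)^c)`.

* `U' → crux`: the polylog-degree regime is the landed sparse regime
  (`monotoneRestorationQP_of_polylogDegree`, here in pointwise form with uniform constants,
  `polylogDegree_pointwise`), the rest is `U'`.
* `crux → U'` (the content): a diagonal / overspill argument (`uniform_of_familywise`).  If `U'`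
  failed at exponent `c₀`, failures occur at every level `c`; at a fixed `n` every polynomial of
  degree `≤ (n+2)^c₀` has SOME symmetric circuit of size bounded in `n` alone (the orbit circuit,
  `OrbitCircuit.exists_symmetric_circuit_of_invariant` + `card_support_le_of_totalDegree_le`), so
  the set of failing levels at `n` is bounded and downward closed; the family picking at each `n` a
  witness failing at the TOP failing level (and `0` where nothing fails) satisfies the hypotheses of
  the crux, and the crux's constant `c` is beaten at the `n` carrying a level-`c` failure.

Consequence for the boundary map: the irreducible open core of V13503 is exactly `U'` (one
polynomial at a time, `c` depending only on `c₀`), in the regime `deg p > (log₂ n + c₀)^c₀`.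
[folklore]
-/

set_option linter.dupNamespace false

namespace Summit.ValiantsHypothesis.ValiantsHypothesis.Theorems

open Summit.ValiantsHypothesis.ValiantsHypothesis.Theses.MonotoneRestoration
open Literature.Computability.AlgebraicComplexity

namespace UniformCore

/-- The quasi-polynomial budget `2^((a + ℓ)^ℓ)` is monotone in the level `ℓ`. [folklore] -/
theorem qpBound_mono (a : ℕ) {ℓ ℓ' : ℕ} (h : ℓ ≤ ℓ') :
    2 ^ ((a + ℓ) ^ ℓ) ≤ 2 ^ ((a + ℓ') ^ ℓ') := by
  apply Nat.pow_le_pow_right (by norm_num)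
  rcases Nat.eq_zero_or_pos (a + ℓ') with h0 | hpos
  · have h1 : ℓ = 0 := by omega
    have h2 : ℓ' = 0 := by omega
    subst h1; subst h2; simp
  · calc (a + ℓ) ^ ℓ ≤ (a + ℓ') ^ ℓ := Nat.pow_le_pow_left (by omega) _
      _ ≤ (a + ℓ') ^ ℓ' := Nat.pow_le_pow_right hpos h

/-- Every finite budget is eventually below the quasi-polynomial budget. [folklore] -/
theorem exists_level_ge (a B : ℕ) : ∃ ℓ : ℕ, B ≤ 2 ^ ((a + ℓ) ^ ℓ) := by
  refine ⟨B, ?_⟩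
  rcases Nat.eq_zero_or_pos B with hB | hB
  · subst hB; simp
  · calc B ≤ 2 ^ B := (Nat.lt_two_pow_self).le
      _ ≤ 2 ^ ((a + B) ^ B) := by
        apply Nat.pow_le_pow_right (by norm_num)
        calc B ≤ a + B := by omega
          _ ≤ (a + B) ^ B := Nat.le_self_pow (by omega) _

/-- **Abstract diagonal lemma.**  Levels `Good ℓ n x` monotone in `ℓ`, every class member good at
SOME level bounded in `n` alone, a default element `z n`, and a family-wise guarantee for every
family drawn from the class `∪ {z}`: then the level is UNIFORM over the class. [folklore] -/
theorem uniform_of_familywise {α : ℕ → Type*} (Cls : ∀ n, α n → Prop)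
    (Good : ℕ → ∀ n, α n → Prop) (z : ∀ n, α n)
    (mono : ∀ ℓ ℓ' n x, ℓ ≤ ℓ' → Good ℓ n x → Good ℓ' n x)
    (bounded : ∀ n, ∃ ℓ, ∀ x, Cls n x → Good ℓ n x)
    (familywise : ∀ f : ∀ n, α n, (∀ n, Cls n (f n) ∨ f n = z n) → ∃ c, ∀ n, Good c n (f n)) :
    ∃ c, ∀ n x, Cls n x → Good c n x := by
  classical
  by_contra hU
  push Not at hU
  -- `m n` = the least level at which every class member at `n` is good
  let m : ℕ → ℕ := fun n => Nat.find (bounded n)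
  have hm_spec : ∀ n x, Cls n x → Good (m n) n x := fun n => Nat.find_spec (bounded n)
  have hm_min : ∀ n, 0 < m n → ∃ x, Cls n x ∧ ¬ Good (m n - 1) n x := by
    intro n hn
    have h := Nat.find_min (bounded n) (show m n - 1 < Nat.find (bounded n) by
      change m n - 1 < m n; omega)
    push Not at h
    exact h
  -- the diagonal family: a top-level failure where there is one, the default elsewhere
  let f : ∀ n, α n := fun n =>
    if hn : 0 < m n then Classical.choose (hm_min n hn) else z n
  have hf : ∀ n, Cls n (f n) ∨ f n = z n := by
    intro n
    by_cases hn : 0 < m n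
    · left
      simp only [f, dif_pos hn]
      exact (Classical.choose_spec (hm_min n hn)).1
    · right
      simp only [f, dif_neg hn]
  obtain ⟨c, hc⟩ := familywise f hf
  obtain ⟨n, x, hx, hbad⟩ := hU c
  have hcn : c < m n := by
    by_contra hle
    push Not at hle
    exact hbad (mono _ _ _ _ hle (hm_spec n x hx))
  have hn : 0 < m n := by omega
  have hfn : f n = Classical.choose (hm_min n hn) := by simp only [f, dif_pos hn]
  have hgood : Good (m n - 1) n (f n) := mono _ _ _ _ (by omega) (hc n)
  rw [hfn] at hgood
  exact (Classical.choose_spec (hm_min n hn)).2 hgood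

/-- **Pointwise sparse regime with uniform constants**: a matrix-symmetric `p ∈ ℝ≥0[x_ij]` of total
degree `≤ (log₂ n + c)^c` has a square-symmetric circuit over `ℂ` of size `≤ 2^((log₂ n + c₁)^c₁)`
with `c₁` depending on `c` only (orbit circuit; `(n² + 1)^deg` monomials). [folklore] -/
theorem polylogDegree_pointwise (c : ℕ) : ∃ c₁ : ℕ, ∀ (n : ℕ)
    (p : MvPolynomial (Fin n × Fin n) NNReal),
    (∀ σ τ : Equiv.Perm (Fin n),
      MvPolynomial.rename (fun q : Fin n × Fin n => (σ q.1, τ q.2)) p = p) →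
    p.totalDegree ≤ (Nat.log 2 n + c) ^ c →
    ∃ (G : Type) (_ : Fintype G) (C : LabelledArithCircuit ℂ (Fin n × Fin n) Unit G),
      C.IsSymmetric (Equiv.Perm (Fin n)) ∧
      C.eval (C.output ()) = MvPolynomial.map (Complex.ofRealHom.comp NNReal.toRealHom) p ∧
      Fintype.card G ≤ 2 ^ ((Nat.log 2 n + c₁) ^ c₁) := by
  obtain ⟨c₁, hc₁⟩ := SparseRegime.polylogDegree_sparse_le c
  obtain ⟨c', hc'⟩ := SparseRegime.qpSparse_size_le c₁
  refine ⟨c', fun n p hsym hdeg => ?_⟩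
  set q : MvPolynomial (Fin n × Fin n) ℂ :=
    MvPolynomial.map (Complex.ofRealHom.comp NNReal.toRealHom) p with hq
  have hinv : ∀ σ : Equiv.Perm (Fin n),
      MvPolynomial.rename (fun pq : Fin n × Fin n => σ • pq) q = q := by
    intro σ
    rw [hq, ← MvPolynomial.map_rename]
    exact congrArg _ (hsym σ σ)
  obtain ⟨G, inst, C, hCs, hCe, hCc⟩ := OrbitCircuit.exists_symmetric_circuit_of_invariant q hinv
  refine ⟨G, inst, C, hCs, hCe, hCc.trans (hc' n _ _ ?_ ?_)⟩
  · calc q.support.card ≤ p.support.card :=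
          Finset.card_le_card (MvPolynomial.support_map_subset _ _)
      _ ≤ (Fintype.card (Fin n × Fin n) + 1) ^ p.totalDegree :=
          OrbitCircuit.card_support_le_of_totalDegree_le p le_rfl
      _ = (n * n + 1) ^ p.totalDegree := by rw [Fintype.card_prod, Fintype.card_fin]
      _ ≤ 2 ^ ((Nat.log 2 n + c₁) ^ c₁) := (hc₁ n _ hdeg).1
  · exact le_trans (Finset.sup_mono (MvPolynomial.support_map_subset _ _)) (hc₁ n _ hdeg).2

/-- **Uniform existence at a fixed `n`**: every matrix-symmetric `p ∈ ℝ≥0[x_ij : i,j<n]` of total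
degree `≤ D` has a square-symmetric circuit over `ℂ` of size bounded in terms of `n` and `D` only
(the orbit circuit). [folklore] -/
theorem exists_symmetric_size_le (n D : ℕ) (p : MvPolynomial (Fin n × Fin n) NNReal)
    (hsym : ∀ σ τ : Equiv.Perm (Fin n),
      MvPolynomial.rename (fun q : Fin n × Fin n => (σ q.1, τ q.2)) p = p)
    (hdeg : p.totalDegree ≤ D) :
    ∃ (G : Type) (_ : Fintype G) (C : LabelledArithCircuit ℂ (Fin n × Fin n) Unit G),
      C.IsSymmetric (Equiv.Perm (Fin n)) ∧
      C.eval (C.output ()) = MvPolynomial.map (Complex.ofRealHom.comp NNReal.toRealHom) p ∧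
      Fintype.card G ≤
        n * n + (n * n + 1) ^ D * (n * n * D) + (n * n + 1) ^ D + (n * n + 1) ^ D + 1 := by
  set q : MvPolynomial (Fin n × Fin n) ℂ :=
    MvPolynomial.map (Complex.ofRealHom.comp NNReal.toRealHom) p with hq
  have hinv : ∀ σ : Equiv.Perm (Fin n),
      MvPolynomial.rename (fun pq : Fin n × Fin n => σ • pq) q = q := by
    intro σ
    rw [hq, ← MvPolynomial.map_rename]
    exact congrArg _ (hsym σ σ)
  obtain ⟨G, inst, C, hCs, hCe, hCc⟩ := OrbitCircuit.exists_symmetric_circuit_of_invariant q hinv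
  have hS : q.support.card ≤ (n * n + 1) ^ D := by
    calc q.support.card ≤ p.support.card :=
          Finset.card_le_card (MvPolynomial.support_map_subset _ _)
      _ ≤ (Fintype.card (Fin n × Fin n) + 1) ^ D :=
          OrbitCircuit.card_support_le_of_totalDegree_le p hdeg
      _ = (n * n + 1) ^ D := by rw [Fintype.card_prod, Fintype.card_fin]
  have hD : q.totalDegree ≤ D :=
    le_trans (Finset.sup_mono (MvPolynomial.support_map_subset _ _)) hdeg
  refine ⟨G, inst, C, hCs, hCe, hCc.trans ?_⟩
  gcongr

end UniformCore

open UniformCore in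
/-- **`MonotoneRestorationQP` is equivalent to its uniform, single-polynomial, high-degree core.**
The crux (families; `∃ c` after the family) holds iff for every exponent `c₀` ONE level `c` serves
every matrix-symmetric `p ∈ ℝ≥0[x_ij : i,j<n]` with `deg p ≤ (n+2)^c₀`, `L⁺(p) ≤ (n+2)^c₀` and
`deg p > (log₂ n + c₀)^c₀` (the polylog-degree regime being the landed sparse regime).
`→` is a diagonal argument (`uniform_of_familywise`); `←` is a case split on the degree. [folklore] -/
theorem monotoneRestorationQP_iff_uniformHighDegree : Summit.ValiantsHypothesis.ValiantsHypothesis.Theses.MonotoneRestoration.MonotoneRestorationQP ↔ ∀ c₀ : ℕ, ∃ c : ℕ, ∀ (n : ℕ) (p : MvPolynomial (Fin n × Fin n) NNReal), (∀ σ τ : Equiv.Perm (Fin n), MvPolynomial.rename (fun q : Fin n × Fin n => (σ q.1, τ q.2)) p = p) → p.totalDegree ≤ (n + 2) ^ c₀ → Literature.Computability.AlgebraicComplexity.complexity p ≤ (n + 2) ^ c₀ → (Nat.log 2 n + c₀) ^ c₀ < p.totalDegree → ∃ (G : Type) (_ : Fintype G) (C : Literature.Computability.AlgebraicComplexity.LabelledArithCircuit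 ℂ (Fin n × Fin n) Unit G), C.IsSymmetric (Equiv.Perm (Fin n)) ∧ C.eval (C.output ()) = MvPolynomial.map (Complex.ofRealHom.comp NNReal.toRealHom) p ∧ Fintype.card G ≤ 2 ^ ((Nat.log 2 n + c) ^ c) := by
  constructor
  · -- crux → uniform core: the diagonal argument
    intro hcrux c₀
    have key := uniform_of_familywise (α := fun n => MvPolynomial (Fin n × Fin n) NNReal)
      (fun n p => (∀ σ τ : Equiv.Perm (Fin n),
          MvPolynomial.rename (fun q : Fin n × Fin n => (σ q.1, τ q.2)) p = p) ∧
        p.totalDegree ≤ (n + 2) ^ c₀ ∧ complexity p ≤ (n + 2) ^ c₀ ∧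
        (Nat.log 2 n + c₀) ^ c₀ < p.totalDegree)
      (fun ℓ n p => ∃ (G : Type) (_ : Fintype G)
          (C : LabelledArithCircuit ℂ (Fin n × Fin n) Unit G),
        C.IsSymmetric (Equiv.Perm (Fin n)) ∧
        C.eval (C.output ()) = MvPolynomial.map (Complex.ofRealHom.comp NNReal.toRealHom) p ∧
        Fintype.card G ≤ 2 ^ ((Nat.log 2 n + ℓ) ^ ℓ))
      (fun n => 0) ?_ ?_ ?_
    · obtain ⟨c, hc⟩ := key
      exact ⟨c, fun n p hsym hdeg hcx hhi => hc n p ⟨hsym, hdeg, hcx, hhi⟩⟩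
    · -- mono
      rintro ℓ ℓ' n p hℓ ⟨G, inst, C, hCs, hCe, hCc⟩
      exact ⟨G, inst, C, hCs, hCe, hCc.trans (qpBound_mono _ hℓ)⟩
    · -- bounded
      intro n
      obtain ⟨ℓ, hℓ⟩ := exists_level_ge (Nat.log 2 n)
        (n * n + (n * n + 1) ^ ((n + 2) ^ c₀) * (n * n * (n + 2) ^ c₀) +
          (n * n + 1) ^ ((n + 2) ^ c₀) + (n * n + 1) ^ ((n + 2) ^ c₀) + 1)
      refine ⟨ℓ, ?_⟩
      rintro p ⟨hsym, hdeg, -, -⟩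
      obtain ⟨G, inst, C, hCs, hCe, hCc⟩ := exists_symmetric_size_le n _ p hsym hdeg
      exact ⟨G, inst, C, hCs, hCe, hCc.trans hℓ⟩
    · -- familywise: the crux applied to a family drawn from the class ∪ {0}
      intro f hf
      refine hcrux f (fun n σ τ => ?_) ⟨c₀, fun n => ?_⟩
      · rcases hf n with h | h
        · exact h.1 σ τ
        · rw [h, map_zero]
      · rcases hf n with h | h
        · exact ⟨h.2.1, h.2.2.1⟩
        · rw [h]
          refine ⟨by simp, ?_⟩
          have h0 : complexity (0 : MvPolynomial (Fin n × Fin n) NNReal) = 0 := by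
            rw [← MvPolynomial.C_0]; exact complexity_C_holds 0
          rw [h0]; exact Nat.zero_le _
  · -- uniform core → crux: split on the degree at each `n`
    rintro hU f hsym ⟨c₀, hc₀⟩
    obtain ⟨c, hc⟩ := hU c₀
    obtain ⟨c₁, hc₁⟩ := polylogDegree_pointwise c₀
    refine ⟨max c c₁, fun n => ?_⟩
    by_cases hdeg : (f n).totalDegree ≤ (Nat.log 2 n + c₀) ^ c₀
    · obtain ⟨G, inst, C, hCs, hCe, hCc⟩ := hc₁ n (f n) (hsym n) hdeg
      exact ⟨G, inst, C, hCs, hCe, hCc.trans (qpBound_mono _ (le_max_right _ _))⟩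
    · obtain ⟨G, inst, C, hCs, hCe, hCc⟩ :=
        hc n (f n) (hsym n) (hc₀ n).1 (hc₀ n).2 (not_le.mp hdeg)
      exact ⟨G, inst, C, hCs, hCe, hCc.trans (qpBound_mono _ (le_max_left _ _))⟩

end Summit.ValiantsHypothesis.ValiantsHypothesis.Theorems
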